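import Literature.Analysis.ValidatedNumerics.TaylorModelBivariateElem
import HarnessLib

/-!
# Trivariate Taylor models: arithmetic, range bounds, the exponential, reciprocal, square root and logarithm

Trunk T-ANA (Analysis/ValidatedNumerics); namespace `Literature.Analysis.ValidatedNumerics.PolyMP`.
Sequel of `TaylorModelBivariate.lean` (bivariate Taylor models `TMem2 S h k f P`: rows of univariate interval
polynomials, the COLLAPSE onto the outer variable, truncation to total degree, the product, `exp`) and
`TaylorModelBivariateElem.lean` (`1/g`, `√g`, `log g` validated from the residual).  The Taylor-model method of
Berz–Makino is stated for boxes `D ⊂ ℝ^v` of any dimension (op. cit. Definition 1) and their verified quadrature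
is HIGH-DIMENSIONAL from the start (Berz–Makino 1999: the integrand modelled over a box of `ℝ^v`, the polynomial
part integrated exactly, the remainder bound multiplied by the volume); this file is the case `v = 3` in the
representation of this library, organised — exactly as the bivariate file is organised over the univariate one —
so that every range bound is INHERITED from dimension two:

* the real shadow `evalR3 rows ρ σ τ = Σᵢ ρⁱ · evalR2 rowsᵢ σ τ` (row `i` = the coefficient of `ρⁱ`, a bivariate
  coefficient array in `σ, τ`), `addR3`, `mulR3`, `evalR3_take_add_drop`;
* `IPoly3 = List IPoly2`, `PMem3` (row-wise `PMem2`) and the membership predicate `TMem3 S h k l f P` on the box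
  `|ρ| ≤ h, |σ| ≤ k, |τ| ≤ l` [op. cit. Definition 1, with interval coefficients];
* the identity models `tconst3`, `tvarX3`, `tvarY3`, `tvarZ3` (Algorithm 2 step 1), `tadd3`, `tneg3`, `tsub3`,
  `tsmulI3`, the product `mul3` and the TRUNCATED product `tmul3 S h k l D` (total degree `D`; rows `i ≤ D` kept,
  row `i` truncated to total `σ, τ`-degree `D − i` by the bivariate `ttrunc2`, the rest bounded on the box and
  folded into the constant coefficient: op. cit. Definition 2), each with its inclusion theorem `tmem3_*`;
* the COLLAPSE `tcollapse3 S k l P` — every row replaced by its bivariate range interval `[tlower2, tupper2]` on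
  `|σ| ≤ k, |τ| ≤ l` — with `tmem_collapse3 : TMem3 … f P → |σ| ≤ k → |τ| ≤ l → TMem S h (f · σ τ) (tcollapse3 …)`,
  whence `tupper3`, `tlower3`, `tabs3`, `tabsLower3` and their soundness are one-liners over `TaylorModel.lean`;
* the intrinsics about the constant part `c = mid000 S G` (op. cit. Definition 3): `thorner3`, `texpComp3`,
  `texp3TM` / `tmem3_exp_of_texp3TM` (`e^{g} = e^{c}·e^{g−c}`); the relative deviation `trelDev3`
  (`u = (g − c)/c`); `tinvVerify3` / `tinv3TM` (ANY candidate for `1/g` validated from `m ≤ |g|·S` and the residual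
  `1 − g·q`), `tsqrtVerify3` / `tsqrt3TM` (`|√g − q|·q ≤ |g − q²|`, Heron constant, binomial series),
  `tlog1p3` / `tlog3TM` (`log g = log c + log(1 + u)`), each returned with its acceptance flag.

The integration of trivariate Taylor models over boxes and kernel-checkable certificates for triple integrals are
in the sequel `TaylorModelIntegralCert3D.lean`.  Problem-independent; no facts, no axioms; all data computable
over `ℤ`.  Cost note: a model of total degree `D` has `(D+1)(D+2)(D+3)/6` coefficients and the truncated product is
quadratic in that number — the generator should prefer more boxes at a lower degree than in two variables.

## References

* K. Makino, M. Berz, *Taylor models and other validated functional inclusion methods*, Int. J. Pure Appl.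
  Math. 4 (2003) 379–456: Definition 1 (multivariate Taylor model on a box of `ℝ^v`), Definition 2 (addition and
  multiplication, the orders `> n` bounded into the remainder), Definition 3 with (2.2)–(2.4) (intrinsics by the
  addition theorems about the constant part), Algorithm 2 (quadrature; step 1 = the identity models).
  [cite: MakinoBerz2003, Definition 1] [cite: MakinoBerz2003, Definition 2] [cite: MakinoBerz2003, Definition 3]
  [cite: MakinoBerz2003, Algorithm 2]
* M. Berz, K. Makino, *New methods for high-dimensional verified quadrature*, Reliable Computing 5 (1999)
  13–22, Sect. 2 (multidimensional Taylor models as the integrand representation). [cite: BerzMakino1999, Sect. 2]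
* M. Joldeş, *Rigorous Polynomial Approximations and Applications*, PhD thesis, ENS Lyon (2011): Section 2.2.1
  (basic functions by Taylor series with remainder), Algorithm 2.2.4 (the reciprocal), Algorithm 2.2.8
  (composition about the constant coefficient). [cite: Joldes2011, Section 2.2.1] [cite: Joldes2011, Algorithm 2.2.4]
  [cite: Joldes2011, Algorithm 2.2.8]
* I. Eble, *Über Taylor-Modelle*, Dissertation, Universität Karlsruhe (2007), §2.2.2 (division, `√`, `log` about
  the constant part after Berz–Makino). [cite: Eble2007, Sect. 2.2.2]
-/

namespace Literature.Analysis.ValidatedNumerics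

namespace PolyMP

open Literature.Analysis.ValidatedNumerics.NumericsMP
open Literature.Analysis.ValidatedNumerics.ExpPoly (Poly)
open Literature.Analysis.ValidatedNumerics.ExpPoly

/-! ### The real shadow: rows of bivariate coefficient arrays -/

/-- Evaluation of a trivariate coefficient array given by rows:
`evalR3 (r :: rs) ρ σ τ = evalR2 r σ τ + ρ · evalR3 rs ρ σ τ` (row `i` = the bivariate coefficient array, in
`σ, τ`, of `ρⁱ`). [cite: MakinoBerz2003, Definition 1] -/
noncomputable def evalR3 : List (List (List ℝ)) → ℝ → ℝ → ℝ → ℝ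
  | [], _, _, _ => 0
  | r :: rs, ρ, σ, τ => evalR2 r σ τ + ρ * evalR3 rs ρ σ τ

/-- [cite: MakinoBerz2003, Definition 1] -/
@[simp] theorem evalR3_nil (ρ σ τ : ℝ) : evalR3 [] ρ σ τ = 0 := rfl

/-- [cite: MakinoBerz2003, Definition 1] -/
@[simp] theorem evalR3_cons (r : List (List ℝ)) (rs : List (List (List ℝ))) (ρ σ τ : ℝ) :
    evalR3 (r :: rs) ρ σ τ = evalR2 r σ τ + ρ * evalR3 rs ρ σ τ := rfl

/-- **Collapse of the inner variables**: `evalR3 rows ρ σ τ` is the univariate evaluation at `ρ` of the list of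
row values at `(σ, τ)`. [cite: MakinoBerz2003, Definition 1] -/
theorem evalR3_eq_evalR_map : ∀ (rs : List (List (List ℝ))) (ρ σ τ : ℝ),
    evalR3 rs ρ σ τ = evalR (rs.map fun r => evalR2 r σ τ) ρ
  | [], _, _, _ => rfl
  | r :: rs, ρ, σ, τ => by
      simp only [evalR3_cons, List.map_cons, evalR_cons, evalR3_eq_evalR_map rs ρ σ τ]

/-- Row-wise sum. [cite: MakinoBerz2003, Definition 2] -/
noncomputable def addR3 : List (List (List ℝ)) → List (List (List ℝ)) → List (List (List ℝ))
  | [], q => q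
  | r :: rs, [] => r :: rs
  | r :: rs, q :: qs => addR2 r q :: addR3 rs qs

/-- [cite: MakinoBerz2003, Definition 2] -/
theorem evalR3_addR3 : ∀ (p q : List (List (List ℝ))) (ρ σ τ : ℝ),
    evalR3 (addR3 p q) ρ σ τ = evalR3 p ρ σ τ + evalR3 q ρ σ τ
  | [], q, _, _, _ => by simp [addR3]
  | r :: rs, [], _, _, _ => by simp [addR3]
  | r :: rs, q :: qs, ρ, σ, τ => by
      simp only [addR3, evalR3_cons, evalR2_addR2, evalR3_addR3 rs qs ρ σ τ]; ring

/-- [cite: MakinoBerz2003, Definition 2] -/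
theorem evalR3_map_mulR2 (r : List (List ℝ)) : ∀ (qs : List (List (List ℝ))) (ρ σ τ : ℝ),
    evalR3 (qs.map (mulR2 r)) ρ σ τ = evalR2 r σ τ * evalR3 qs ρ σ τ
  | [], _, _, _ => by simp
  | q :: qs, ρ, σ, τ => by
      simp only [List.map_cons, evalR3_cons, evalR2_mulR2, evalR3_map_mulR2 r qs ρ σ τ]; ring

/-- Product of coefficient arrays: `(r + ρ·rs)·q = r·q + ρ·(rs·q)` row-wise. [cite: MakinoBerz2003, Definition 2] -/
noncomputable def mulR3 : List (List (List ℝ)) → List (List (List ℝ)) → List (List (List ℝ))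
  | [], _ => []
  | r :: rs, qs => addR3 (qs.map (mulR2 r)) ([] :: mulR3 rs qs)

/-- [cite: MakinoBerz2003, Definition 2] -/
theorem evalR3_mulR3 : ∀ (p q : List (List (List ℝ))) (ρ σ τ : ℝ),
    evalR3 (mulR3 p q) ρ σ τ = evalR3 p ρ σ τ * evalR3 q ρ σ τ
  | [], q, _, _, _ => by simp [mulR3]
  | r :: rs, qs, ρ, σ, τ => by
      simp only [mulR3, evalR3_addR3, evalR3_map_mulR2, evalR3_cons, evalR2_nil, evalR3_mulR3 rs qs ρ σ τ]; ring

/-- [cite: MakinoBerz2003, Definition 2] -/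
theorem evalR3_map_neg : ∀ (p : List (List (List ℝ))) (ρ σ τ : ℝ),
    evalR3 (p.map fun r => r.map fun c => c.map Neg.neg) ρ σ τ = -evalR3 p ρ σ τ
  | [], _, _, _ => by simp
  | r :: rs, ρ, σ, τ => by
      simp only [List.map_cons, evalR3_cons, evalR2_map_neg, evalR3_map_neg rs ρ σ τ]; ring

/-- [cite: MakinoBerz2003, Definition 2] -/
theorem evalR3_map_smulR (c : ℝ) : ∀ (p : List (List (List ℝ))) (ρ σ τ : ℝ),
    evalR3 (p.map fun r => r.map (smulR c)) ρ σ τ = c * evalR3 p ρ σ τ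
  | [], _, _, _ => by simp
  | r :: rs, ρ, σ, τ => by
      simp only [List.map_cons, evalR3_cons, evalR2_map_smulR, evalR3_map_smulR c rs ρ σ τ]; ring

/-- Evaluation splits at any row index: `p = (take n p) + ρⁿ · (drop n p)`. [cite: MakinoBerz2003, Definition 2] -/
theorem evalR3_take_add_drop : ∀ (n : ℕ) (p : List (List (List ℝ))) (ρ σ τ : ℝ),
    evalR3 p ρ σ τ = evalR3 (p.take n) ρ σ τ + ρ ^ n * evalR3 (p.drop n) ρ σ τ
  | 0, p, _, _, _ => by simp
  | n + 1, [], _, _, _ => by simp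
  | n + 1, r :: rs, ρ, σ, τ => by
      simp only [List.take_succ_cons, List.drop_succ_cons, evalR3_cons, evalR3_take_add_drop n rs ρ σ τ]; ring

/-! ### Interval rows and the membership predicate -/

/-- Trivariate interval polynomials: lists of rows, row `i` an `IPoly2` in `σ, τ` (the coefficient of `ρⁱ`).
[cite: MakinoBerz2003, Definition 1] -/
abbrev IPoly3 := List IPoly2

/-- Row-wise coefficient membership. [cite: MakinoBerz2003, Definition 1] -/
def PMem3 (S : ℕ) (p : List (List (List ℝ))) (P : IPoly3) : Prop := List.Forall₂ (PMem2 S) p P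

/-- [cite: MakinoBerz2003, Definition 1] -/
theorem pmem3_nil (S : ℕ) : PMem3 S [] [] := List.Forall₂.nil

/-- [cite: MakinoBerz2003, Definition 1] -/
theorem pmem3_cons {S : ℕ} {r : List (List ℝ)} {R : IPoly2} {rs : List (List (List ℝ))} {Rs : IPoly3}
    (h : PMem2 S r R) (hs : PMem3 S rs Rs) : PMem3 S (r :: rs) (R :: Rs) := List.Forall₂.cons h hs

/-- [folklore] -/
private theorem pmem3_take {S : ℕ} : ∀ (n : ℕ) {p : List (List (List ℝ))} {P : IPoly3}, PMem3 S p P →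
    PMem3 S (p.take n) (P.take n)
  | 0, _, _, _ => by simpa using pmem3_nil S
  | n + 1, _, _, List.Forall₂.nil => by simpa using pmem3_nil S
  | n + 1, _, _, List.Forall₂.cons hr hP => by
      simp only [List.take_succ_cons]; exact pmem3_cons hr (pmem3_take n hP)

/-- [folklore] -/
private theorem pmem3_drop {S : ℕ} : ∀ (n : ℕ) {p : List (List (List ℝ))} {P : IPoly3}, PMem3 S p P →
    PMem3 S (p.drop n) (P.drop n)
  | 0, _, _, h => by simpa using h
  | n + 1, _, _, List.Forall₂.nil => by simpa using pmem3_nil S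
  | n + 1, _, _, List.Forall₂.cons hr hP => by
      simp only [List.drop_succ_cons]; exact pmem3_drop n hP

/-- **Trivariate Taylor-model membership** on the box `|ρ| ≤ h, |σ| ≤ k, |τ| ≤ l`: `f ρ σ τ = Σ aᵢⱼₘ ρⁱ σʲ τᵐ` for
some array of coefficients `aᵢⱼₘ ∈ Pᵢⱼₘ` (depending on the point; the remainder lives in the interval
coefficients). [cite: MakinoBerz2003, Definition 1] [cite: BerzMakino1999, Sect. 2] -/
def TMem3 (S : ℕ) (h k l : ℚ) (f : ℝ → ℝ → ℝ → ℝ) (P : IPoly3) : Prop :=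
  ∀ ρ σ τ : ℝ, |ρ| ≤ h → |σ| ≤ k → |τ| ≤ l → ∃ p : List (List (List ℝ)), PMem3 S p P ∧ f ρ σ τ = evalR3 p ρ σ τ

/-! ### Constants and the three identity variables -/

/-- A constant. [cite: MakinoBerz2003, Algorithm 2] -/
def tconst3 (I : MI) : IPoly3 := [[[I]]]

/-- [cite: MakinoBerz2003, Algorithm 2] -/
theorem tmem3_const {S : ℕ} {h k l : ℚ} {x : ℝ} {I : MI} (hx : MI.mem S x I) :
    TMem3 S h k l (fun _ _ _ => x) (tconst3 I) := fun ρ σ τ _ _ _ =>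
  ⟨[[[x]]], pmem3_cons (pmem2_cons (pmem_cons hx (pmem_nil S)) (pmem2_nil S)) (pmem3_nil S), by simp⟩

/-- The first variable `(ρ, σ, τ) ↦ c + ρ` (identity Taylor model, remainder zero). [cite: MakinoBerz2003, Algorithm 2] -/
def tvarX3 (S : ℕ) (C : MI) : IPoly3 := [[[C]], [[MI.ofInt S 1]]]

/-- [cite: MakinoBerz2003, Algorithm 2] -/
theorem tmem3_varX {S : ℕ} {h k l : ℚ} {c : ℝ} {C : MI} (hc : MI.mem S c C) :
    TMem3 S h k l (fun ρ _ _ => c + ρ) (tvarX3 S C) := fun ρ σ τ _ _ _ =>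
  ⟨[[[c]], [[1]]], pmem3_cons (pmem2_cons (pmem_cons hc (pmem_nil S)) (pmem2_nil S))
    (pmem3_cons (pmem2_cons (pmem_cons (by simpa using MI.mem_ofInt S 1) (pmem_nil S)) (pmem2_nil S))
      (pmem3_nil S)), by simp⟩

/-- The second variable `(ρ, σ, τ) ↦ c + σ`. [cite: MakinoBerz2003, Algorithm 2] -/
def tvarY3 (S : ℕ) (C : MI) : IPoly3 := [[[C], [MI.ofInt S 1]]]

/-- [cite: MakinoBerz2003, Algorithm 2] -/
theorem tmem3_varY {S : ℕ} {h k l : ℚ} {c : ℝ} {C : MI} (hc : MI.mem S c C) :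
    TMem3 S h k l (fun _ σ _ => c + σ) (tvarY3 S C) := fun ρ σ τ _ _ _ =>
  ⟨[[[c], [1]]], pmem3_cons (pmem2_cons (pmem_cons hc (pmem_nil S))
    (pmem2_cons (pmem_cons (by simpa using MI.mem_ofInt S 1) (pmem_nil S)) (pmem2_nil S))) (pmem3_nil S),
    by simp⟩

/-- The third variable `(ρ, σ, τ) ↦ c + τ`. [cite: MakinoBerz2003, Algorithm 2] -/
def tvarZ3 (S : ℕ) (C : MI) : IPoly3 := [[[C, MI.ofInt S 1]]]

/-- [cite: MakinoBerz2003, Algorithm 2] -/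
theorem tmem3_varZ {S : ℕ} {h k l : ℚ} {c : ℝ} {C : MI} (hc : MI.mem S c C) :
    TMem3 S h k l (fun _ _ τ => c + τ) (tvarZ3 S C) := fun ρ σ τ _ _ _ =>
  ⟨[[[c, 1]]], pmem3_cons (pmem2_cons (pmem_cons hc (pmem_cons (by simpa using MI.mem_ofInt S 1) (pmem_nil S)))
    (pmem2_nil S)) (pmem3_nil S), by simp⟩

/-! ### Linear operations -/

/-- Row-wise sum. [cite: MakinoBerz2003, Definition 2] -/
def tadd3 : IPoly3 → IPoly3 → IPoly3
  | [], Q => Q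
  | R :: Rs, [] => R :: Rs
  | R :: Rs, Q :: Qs => tadd2 R Q :: tadd3 Rs Qs

/-- [cite: MakinoBerz2003, Definition 2] -/
theorem pmem3_add {S : ℕ} : ∀ {p q : List (List (List ℝ))} {P Q : IPoly3}, PMem3 S p P → PMem3 S q Q →
    PMem3 S (addR3 p q) (tadd3 P Q)
  | _, _, _, _, List.Forall₂.nil, hQ => by simpa [addR3, tadd3] using hQ
  | _, _, _, _, List.Forall₂.cons hr hP, List.Forall₂.nil => by
      simp only [addR3, tadd3]; exact List.Forall₂.cons hr hP
  | _, _, _, _, List.Forall₂.cons hr hP, List.Forall₂.cons hq hQ => by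
      simp only [addR3, tadd3]; exact List.Forall₂.cons (pmem2_add hr hq) (pmem3_add hP hQ)

/-- **Sum of trivariate Taylor models.** [cite: MakinoBerz2003, Definition 2] -/
theorem tmem3_add {S : ℕ} {h k l : ℚ} {f g : ℝ → ℝ → ℝ → ℝ} {P Q : IPoly3} (hf : TMem3 S h k l f P)
    (hg : TMem3 S h k l g Q) : TMem3 S h k l (fun ρ σ τ => f ρ σ τ + g ρ σ τ) (tadd3 P Q) :=
  fun ρ σ τ hρ hσ hτ => by
  obtain ⟨p, hp, ef⟩ := hf ρ σ τ hρ hσ hτ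
  obtain ⟨q, hq, eg⟩ := hg ρ σ τ hρ hσ hτ
  exact ⟨addR3 p q, pmem3_add hp hq, by simp only [evalR3_addR3, ef, eg]⟩

/-- Negation. [cite: MakinoBerz2003, Definition 2] -/
def tneg3 (P : IPoly3) : IPoly3 := P.map tneg2

/-- [folklore] -/
private theorem pmem2_neg_tv {S : ℕ} : ∀ {p : List (List ℝ)} {P : IPoly2}, PMem2 S p P →
    PMem2 S (p.map fun r => r.map Neg.neg) (tneg2 P)
  | _, _, List.Forall₂.nil => by simpa [tneg2] using pmem2_nil S
  | _, _, List.Forall₂.cons hr hP => by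
      simp only [List.map_cons, tneg2]; exact List.Forall₂.cons (pmem_neg hr) (pmem2_neg_tv hP)

/-- [folklore] -/
private theorem pmem3_neg {S : ℕ} : ∀ {p : List (List (List ℝ))} {P : IPoly3}, PMem3 S p P →
    PMem3 S (p.map fun r => r.map fun c => c.map Neg.neg) (tneg3 P)
  | _, _, List.Forall₂.nil => by simpa [tneg3] using pmem3_nil S
  | _, _, List.Forall₂.cons hr hP => by
      simp only [List.map_cons, tneg3]; exact List.Forall₂.cons (pmem2_neg_tv hr) (pmem3_neg hP)

/-- **Negation of a trivariate Taylor model.** [cite: MakinoBerz2003, Definition 2] -/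
theorem tmem3_neg {S : ℕ} {h k l : ℚ} {f : ℝ → ℝ → ℝ → ℝ} {P : IPoly3} (hf : TMem3 S h k l f P) :
    TMem3 S h k l (fun ρ σ τ => -f ρ σ τ) (tneg3 P) := fun ρ σ τ hρ hσ hτ => by
  obtain ⟨p, hp, ef⟩ := hf ρ σ τ hρ hσ hτ
  exact ⟨p.map fun r => r.map fun c => c.map Neg.neg, pmem3_neg hp, by simp only [evalR3_map_neg, ef]⟩

/-- Difference. [cite: MakinoBerz2003, Definition 2] -/
def tsub3 (P Q : IPoly3) : IPoly3 := tadd3 P (tneg3 Q)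

/-- [cite: MakinoBerz2003, Definition 2] -/
theorem tmem3_sub {S : ℕ} {h k l : ℚ} {f g : ℝ → ℝ → ℝ → ℝ} {P Q : IPoly3} (hf : TMem3 S h k l f P)
    (hg : TMem3 S h k l g Q) : TMem3 S h k l (fun ρ σ τ => f ρ σ τ - g ρ σ τ) (tsub3 P Q) := by
  have := tmem3_add hf (tmem3_neg hg)
  simpa [sub_eq_add_neg, tsub3] using this

/-- Product with an interval constant (row-wise `tsmulI2`). [cite: MakinoBerz2003, Definition 2] -/
def tsmulI3 (S : ℕ) (C : MI) (P : IPoly3) : IPoly3 := P.map (tsmulI2 S C)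

/-- [folklore] -/
private theorem pmem2_smulI_tv {S : ℕ} (hS : 0 < S) {c : ℝ} {C : MI} (hc : MI.mem S c C) :
    ∀ {p : List (List ℝ)} {P : IPoly2}, PMem2 S p P → PMem2 S (p.map (smulR c)) (tsmulI2 S C P)
  | _, _, List.Forall₂.nil => by simpa [tsmulI2] using pmem2_nil S
  | _, _, List.Forall₂.cons hr hP => by
      simp only [List.map_cons, tsmulI2]
      exact List.Forall₂.cons (pmem_smulI hS hc hr) (pmem2_smulI_tv hS hc hP)

/-- [folklore] -/
private theorem pmem3_smulI {S : ℕ} (hS : 0 < S) {c : ℝ} {C : MI} (hc : MI.mem S c C) :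
    ∀ {p : List (List (List ℝ))} {P : IPoly3}, PMem3 S p P → PMem3 S (p.map fun r => r.map (smulR c)) (tsmulI3 S C P)
  | _, _, List.Forall₂.nil => by simpa [tsmulI3] using pmem3_nil S
  | _, _, List.Forall₂.cons hr hP => by
      simp only [List.map_cons, tsmulI3]
      exact List.Forall₂.cons (pmem2_smulI_tv hS hc hr) (pmem3_smulI hS hc hP)

/-- **Interval multiple of a trivariate Taylor model.** [cite: MakinoBerz2003, Definition 2] -/
theorem tmem3_smulI {S : ℕ} (hS : 0 < S) {h k l : ℚ} {c : ℝ} {C : MI} (hc : MI.mem S c C)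
    {f : ℝ → ℝ → ℝ → ℝ} {P : IPoly3} (hf : TMem3 S h k l f P) :
    TMem3 S h k l (fun ρ σ τ => c * f ρ σ τ) (tsmulI3 S C P) := fun ρ σ τ hρ hσ hτ => by
  obtain ⟨p, hp, ef⟩ := hf ρ σ τ hρ hσ hτ
  exact ⟨p.map fun r => r.map (smulR c), pmem3_smulI hS hc hp, by simp only [evalR3_map_smulR, ef]⟩

/-! ### The collapse onto the outer variable and the range bounds -/

/-- **Collapse**: replace every row by its scaled bivariate range interval `[tlower2, tupper2]` on
`|σ| ≤ k, |τ| ≤ l`; the result is a univariate interval polynomial in `ρ`. [cite: MakinoBerz2003, Definition 2] -/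
def tcollapse3 (S : ℕ) (k l : ℚ) (P : IPoly3) : IPoly :=
  P.map fun R => (⟨tlower2 S k l R, tupper2 S k l R⟩ : MI)

/-- [folklore] -/
private theorem pmem_collapse3 {S : ℕ} {k l : ℚ} (k0 : 0 ≤ k) (l0 : 0 ≤ l) {σ τ : ℝ} (hσ : |σ| ≤ k)
    (hτ : |τ| ≤ l) : ∀ {p : List (List (List ℝ))} {P : IPoly3}, PMem3 S p P →
      PMem S (p.map fun r => evalR2 r σ τ) (tcollapse3 S k l P)
  | _, _, List.Forall₂.nil => by simpa [tcollapse3] using pmem_nil S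
  | _, _, List.Forall₂.cons (a := r) (b := R) hr hP => by
      simp only [List.map_cons, tcollapse3]
      have hT : TMem2 S k l (fun σ' τ' => evalR2 r σ' τ') R := fun σ' τ' _ _ => ⟨r, hr, rfl⟩
      exact pmem_cons ⟨tlower2_le k0 l0 hT hσ hτ, le_tupper2 k0 l0 hT hσ hτ⟩ (pmem_collapse3 k0 l0 hσ hτ hP)

/-- **Soundness of the collapse**: every `(σ, τ)`-section of a trivariate Taylor model is a univariate Taylor
model with coefficients in the collapsed rows. [cite: MakinoBerz2003, Definition 2] -/
theorem tmem_collapse3 {S : ℕ} {h k l : ℚ} (k0 : 0 ≤ k) (l0 : 0 ≤ l) {f : ℝ → ℝ → ℝ → ℝ} {P : IPoly3}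
    (hf : TMem3 S h k l f P) {σ τ : ℝ} (hσ : |σ| ≤ k) (hτ : |τ| ≤ l) :
    TMem S h (fun ρ => f ρ σ τ) (tcollapse3 S k l P) := fun ρ hρ => by
  obtain ⟨p, hp, ef⟩ := hf ρ σ τ hρ hσ hτ
  exact ⟨p.map fun r => evalR2 r σ τ, pmem_collapse3 k0 l0 hσ hτ hp, by
    show f ρ σ τ = _
    rw [ef, evalR3_eq_evalR_map]⟩

/-- Scaled upper bound of `f` on the box. [cite: MakinoBerz2003, Definition 2] -/
def tupper3 (S : ℕ) (h k l : ℚ) (P : IPoly3) : ℤ := tupperI S h (tcollapse3 S k l P)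

/-- Scaled lower bound of `f` on the box. [cite: MakinoBerz2003, Definition 2] -/
def tlower3 (S : ℕ) (h k l : ℚ) (P : IPoly3) : ℤ := tlowerI S h (tcollapse3 S k l P)

/-- Scaled bound of `|f|` on the box. [cite: MakinoBerz2003, Definition 2] -/
def tabs3 (S : ℕ) (h k l : ℚ) (P : IPoly3) : ℤ := tabsI S h (tcollapse3 S k l P)

/-- [cite: MakinoBerz2003, Definition 2] -/
theorem le_tupper3 {S : ℕ} {h k l : ℚ} (h0 : 0 ≤ h) (k0 : 0 ≤ k) (l0 : 0 ≤ l) {f : ℝ → ℝ → ℝ → ℝ} {P : IPoly3}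
    (hf : TMem3 S h k l f P) {ρ σ τ : ℝ} (hρ : |ρ| ≤ h) (hσ : |σ| ≤ k) (hτ : |τ| ≤ l) :
    f ρ σ τ * S ≤ (tupper3 S h k l P : ℝ) :=
  le_tupperI h0 (tmem_collapse3 k0 l0 hf hσ hτ) hρ

/-- [cite: MakinoBerz2003, Definition 2] -/
theorem tlower3_le {S : ℕ} {h k l : ℚ} (h0 : 0 ≤ h) (k0 : 0 ≤ k) (l0 : 0 ≤ l) {f : ℝ → ℝ → ℝ → ℝ} {P : IPoly3}
    (hf : TMem3 S h k l f P) {ρ σ τ : ℝ} (hρ : |ρ| ≤ h) (hσ : |σ| ≤ k) (hτ : |τ| ≤ l) :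
    (tlower3 S h k l P : ℝ) ≤ f ρ σ τ * S :=
  tlowerI_le h0 (tmem_collapse3 k0 l0 hf hσ hτ) hρ

/-- [cite: MakinoBerz2003, Definition 2] -/
theorem abs_le_tabs3 {S : ℕ} {h k l : ℚ} (h0 : 0 ≤ h) (k0 : 0 ≤ k) (l0 : 0 ≤ l) {f : ℝ → ℝ → ℝ → ℝ} {P : IPoly3}
    (hf : TMem3 S h k l f P) {ρ σ τ : ℝ} (hρ : |ρ| ≤ h) (hσ : |σ| ≤ k) (hτ : |τ| ≤ l) :
    |f ρ σ τ| * S ≤ (tabs3 S h k l P : ℝ) :=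
  abs_le_tabsI h0 (tmem_collapse3 k0 l0 hf hσ hτ) hρ

/-- Scaled lower bound of `|f|` on the box: `max (tlower3, −tupper3)`. [cite: Joldes2011, Algorithm 2.2.4] -/
def tabsLower3 (S : ℕ) (h k l : ℚ) (P : IPoly3) : ℤ := max (tlower3 S h k l P) (-tupper3 S h k l P)

/-- [cite: Joldes2011, Algorithm 2.2.4] -/
theorem tabsLower3_le {S : ℕ} {h k l : ℚ} (h0 : 0 ≤ h) (k0 : 0 ≤ k) (l0 : 0 ≤ l) {f : ℝ → ℝ → ℝ → ℝ}
    {P : IPoly3} (hf : TMem3 S h k l f P) {ρ σ τ : ℝ} (hρ : |ρ| ≤ h) (hσ : |σ| ≤ k) (hτ : |τ| ≤ l) :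
    (tabsLower3 S h k l P : ℝ) ≤ |f ρ σ τ| * S := by
  have h1 := le_tupper3 h0 k0 l0 hf hρ hσ hτ
  have h2 := tlower3_le h0 k0 l0 hf hρ hσ hτ
  simp only [tabsLower3, Int.cast_max, Int.cast_neg]
  have hS0 : (0 : ℝ) ≤ S := by positivity
  rcases le_total 0 (f ρ σ τ) with hp | hn
  · rw [abs_of_nonneg hp]
    have : 0 ≤ f ρ σ τ * S := mul_nonneg hp hS0
    exact max_le h2 (by linarith)
  · rw [abs_of_nonpos hn]
    have : f ρ σ τ * S ≤ 0 := mul_nonpos_of_nonpos_of_nonneg hn hS0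
    exact max_le (by linarith) (by linarith)

/-! ### Truncation and the product -/

/-- Widen the constant coefficient (row `0` of row `0` of row `0`). [cite: MakinoBerz2003, Definition 2] -/
def widen000 (P : IPoly3) (e : ℤ) : IPoly3 :=
  match P with
  | [] => [[[⟨-e, e⟩]]]
  | R :: Rs => widen00 R e :: Rs

/-- Folding a perturbation of the value into the constant coefficient. [cite: MakinoBerz2003, Definition 2] -/
theorem exists_widen000 {S : ℕ} {p : List (List (List ℝ))} {P : IPoly3} (hp : PMem3 S p P) {δ : ℝ} {e : ℤ}
    (hδ : |δ| * S ≤ e) (ρ σ τ : ℝ) :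
    ∃ q : List (List (List ℝ)), PMem3 S q (widen000 P e) ∧ evalR3 q ρ σ τ = evalR3 p ρ σ τ + δ := by
  match p, P, hp with
  | [], [], _ =>
    obtain ⟨bs, hbs, ebs⟩ := exists_widen00 (pmem2_nil S) hδ σ τ
    exact ⟨[bs], pmem3_cons hbs (pmem3_nil S), by simp [ebs]⟩
  | r :: rs, R :: Rs, List.Forall₂.cons hr hRs =>
    obtain ⟨bs, hbs, ebs⟩ := exists_widen00 hr hδ σ τ
    exact ⟨bs :: rs, pmem3_cons hbs hRs, by simp [ebs]; ring⟩

/-- Row-wise truncation with decreasing total degree: row `0` to total `σ, τ`-degree `D`, row `1` to `D − 1`, …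
(total degree `D` in the three variables). [cite: MakinoBerz2003, Definition 2] -/
def ttruncRows3 (S : ℕ) (k l : ℚ) : ℕ → IPoly3 → IPoly3
  | _, [] => []
  | D, R :: Rs => ttrunc2 S k l D R :: ttruncRows3 S k l (D - 1) Rs

/-- [folklore] -/
private theorem exists_ttruncRows3 {S : ℕ} {k l : ℚ} (k0 : 0 ≤ k) (l0 : 0 ≤ l) {σ τ : ℝ} (hσ : |σ| ≤ k)
    (hτ : |τ| ≤ l) (ρ : ℝ) : ∀ (D : ℕ) {p : List (List (List ℝ))} {P : IPoly3}, PMem3 S p P →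
      ∃ q : List (List (List ℝ)), PMem3 S q (ttruncRows3 S k l D P) ∧ evalR3 q ρ σ τ = evalR3 p ρ σ τ
  | D, _, _, List.Forall₂.nil => ⟨[], pmem3_nil S, rfl⟩
  | D, _, _, List.Forall₂.cons (a := r) (b := R) hr hP => by
      have hT : TMem2 S k l (fun σ' τ' => evalR2 r σ' τ') R := fun σ' τ' _ _ => ⟨r, hr, rfl⟩
      obtain ⟨bs, hbs, ebs⟩ := tmem2_trunc k0 l0 D hT σ τ hσ hτ
      obtain ⟨q, hq, eq⟩ := exists_ttruncRows3 k0 l0 hσ hτ ρ (D - 1) hP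
      exact ⟨bs :: q, pmem3_cons hbs hq, by simp only [evalR3_cons, eq, ← ebs]⟩

/-- **Truncation to total degree `D`**: rows `0 … D` are kept (row `i` cut to total degree `D − i`), the rows
beyond `D` are bounded on the box (`tailBoundI` of the collapsed rows) and folded into the constant coefficient.
[cite: MakinoBerz2003, Definition 2] -/
def ttrunc3 (S : ℕ) (h k l : ℚ) (D : ℕ) (P : IPoly3) : IPoly3 :=
  widen000 (ttruncRows3 S k l D (P.take (D + 1))) (tailBoundI S h (D + 1) (tcollapse3 S k l (P.drop (D + 1))))

/-- **Soundness of the truncation.** [cite: MakinoBerz2003, Definition 2] -/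
theorem tmem3_trunc {S : ℕ} {h k l : ℚ} (h0 : 0 ≤ h) (k0 : 0 ≤ k) (l0 : 0 ≤ l) (D : ℕ) {f : ℝ → ℝ → ℝ → ℝ}
    {P : IPoly3} (hf : TMem3 S h k l f P) : TMem3 S h k l f (ttrunc3 S h k l D P) := fun ρ σ τ hρ hσ hτ => by
  obtain ⟨p, hp, ef⟩ := hf ρ σ τ hρ hσ hτ
  have hsplit := evalR3_take_add_drop (D + 1) p ρ σ τ
  have htail := tail_le_tailBoundI h0 (D + 1) (pmem_collapse3 k0 l0 hσ hτ (pmem3_drop (D + 1) hp)) hρ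
  obtain ⟨q, hq, eq⟩ := exists_ttruncRows3 k0 l0 hσ hτ ρ D (pmem3_take (D + 1) hp)
  obtain ⟨q', hq', eq'⟩ := exists_widen000 hq htail ρ σ τ
  refine ⟨q', hq', ?_⟩
  rw [eq', eq, ef, hsplit, evalR3_eq_evalR_map (p.drop (D + 1))]

/-- The full row-wise product (degree doubling; rows multiplied by the bivariate `mul2`). [cite: MakinoBerz2003, Definition 2] -/
def mul3 (S : ℕ) : IPoly3 → IPoly3 → IPoly3
  | [], _ => []
  | R :: Rs, Qs => tadd3 (Qs.map (mul2 S R)) ([] :: mul3 S Rs Qs)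

/-- [folklore] -/
private theorem pmem3_map_mul2 {S : ℕ} (hS : 0 < S) {r : List (List ℝ)} {R : IPoly2} (hr : PMem2 S r R) :
    ∀ {q : List (List (List ℝ))} {Q : IPoly3}, PMem3 S q Q → PMem3 S (q.map (mulR2 r)) (Q.map (mul2 S R))
  | _, _, List.Forall₂.nil => by simpa using pmem3_nil S
  | _, _, List.Forall₂.cons hq hQ => by
      simp only [List.map_cons]; exact pmem3_cons (pmem2_mul2 hS hr hq) (pmem3_map_mul2 hS hr hQ)

/-- [cite: MakinoBerz2003, Definition 2] -/
theorem pmem3_mul3 {S : ℕ} (hS : 0 < S) : ∀ {p q : List (List (List ℝ))} {P Q : IPoly3}, PMem3 S p P →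
    PMem3 S q Q → PMem3 S (mulR3 p q) (mul3 S P Q)
  | _, _, _, _, List.Forall₂.nil, _ => by simpa [mulR3, mul3] using pmem3_nil S
  | _, _, _, _, List.Forall₂.cons hr hP, hQ => by
      simp only [mulR3, mul3]
      exact pmem3_add (pmem3_map_mul2 hS hr hQ) (pmem3_cons (pmem2_nil S) (pmem3_mul3 hS hP hQ))

/-- **The truncated product** of trivariate Taylor models (total degree `D`). [cite: MakinoBerz2003, Definition 2] -/
def tmul3 (S : ℕ) (h k l : ℚ) (D : ℕ) (P Q : IPoly3) : IPoly3 := ttrunc3 S h k l D (mul3 S P Q)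

/-- **Soundness of the truncated product.** [cite: MakinoBerz2003, Definition 2] -/
theorem tmem3_mul {S : ℕ} (hS : 0 < S) {h k l : ℚ} (h0 : 0 ≤ h) (k0 : 0 ≤ k) (l0 : 0 ≤ l) (D : ℕ)
    {f g : ℝ → ℝ → ℝ → ℝ} {P Q : IPoly3} (hf : TMem3 S h k l f P) (hg : TMem3 S h k l g Q) :
    TMem3 S h k l (fun ρ σ τ => f ρ σ τ * g ρ σ τ) (tmul3 S h k l D P Q) := by
  refine tmem3_trunc h0 k0 l0 D fun ρ σ τ hρ hσ hτ => ?_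
  obtain ⟨p, hp, ef⟩ := hf ρ σ τ hρ hσ hτ
  obtain ⟨q, hq, eg⟩ := hg ρ σ τ hρ hσ hτ
  exact ⟨mulR3 p q, pmem3_mul3 hS hp hq, by rw [evalR3_mulR3, ef, eg]⟩

/-! ### Rational polynomials of a trivariate Taylor model and the exponential -/

/-- `p(u(ρ, σ, τ))` in trivariate Taylor-model arithmetic, `p` a rational coefficient list (Horner).
[cite: MakinoBerz2003, Definition 3] -/
def thorner3 (S : ℕ) (h k l : ℚ) (D : ℕ) : List ℚ → IPoly3 → IPoly3
  | [], _ => tconst3 (MI.ofInt S 0)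
  | c :: cs, U => tadd3 (tconst3 (ofRat S c)) (tmul3 S h k l D U (thorner3 S h k l D cs U))

/-- **Soundness of `thorner3`.** [cite: MakinoBerz2003, Definition 3] -/
theorem tmem3_horner {S : ℕ} (hS : 0 < S) {h k l : ℚ} (h0 : 0 ≤ h) (k0 : 0 ≤ k) (l0 : 0 ≤ l) (D : ℕ)
    {u : ℝ → ℝ → ℝ → ℝ} {U : IPoly3} (hu : TMem3 S h k l u U) :
    ∀ cs : List ℚ, TMem3 S h k l (fun ρ σ τ => Poly.eval cs (u ρ σ τ)) (thorner3 S h k l D cs U)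
  | [] => by
      simpa [thorner3] using (tmem3_const (h := h) (k := k) (l := l) (MI.mem_ofInt S 0))
  | c :: cs => by
      have ih := tmem3_horner hS h0 k0 l0 D hu cs
      have := tmem3_add (tmem3_const (h := h) (k := k) (l := l) (mem_ofRat S c)) (tmem3_mul hS h0 k0 l0 D hu ih)
      simpa [thorner3, Poly.eval] using this

/-- The exponential series with remainder (`Real.exp_bound`): for `|u| ≤ 1` and `0 < K`,
`|e^{u} − Σ_{k<K} u^k/k!| ≤ |u|^K (K+1)/(K!·K)`. [folklore] -/
private theorem abs_exp_sub_eval_expSer_le_tv {u : ℝ} (hu : |u| ≤ 1) {K : ℕ} (hK : 0 < K) :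
    |Real.exp u - Poly.eval (expSerCoeffs K) u| ≤ |u| ^ K * ((K + 1 : ℝ) / ((K.factorial : ℝ) * K)) := by
  have h := Real.exp_bound hu hK
  have hs : Poly.eval (expSerCoeffs K) u = ∑ m ∈ Finset.range K, u ^ m / m.factorial := by
    rw [expSerCoeffs, poly_eval_map_range]
    refine Finset.sum_congr rfl fun k _ => ?_
    push_cast
    ring
  rw [hs]
  convert h using 2
  push_cast
  ring

/-- The trivariate Taylor model of `e^{u}` for a small `u` (`|u| ≤ 1` certified by `tabs3 ≤ S`): Horner on the
exponential series plus the remainder folded into the constant coefficient. [cite: MakinoBerz2003, Definition 3] -/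
def texpComp3 (S : ℕ) (h k l : ℚ) (D K : ℕ) (U : IPoly3) : IPoly3 :=
  widen000 (thorner3 S h k l D (expSerCoeffs K) U) (texpCompRem S (tabs3 S h k l U) K)

/-- **Soundness of `texpComp3`** (`0 < K`, `tabs3 S h k l U ≤ S`). [cite: MakinoBerz2003, Definition 3]
[cite: Joldes2011, Section 2.2.1] -/
theorem tmem3_expComp {S : ℕ} (hS : 0 < S) {h k l : ℚ} (h0 : 0 ≤ h) (k0 : 0 ≤ k) (l0 : 0 ≤ l) (D : ℕ) {K : ℕ}
    (hK : 0 < K) {u : ℝ → ℝ → ℝ → ℝ} {U : IPoly3} (hu : TMem3 S h k l u U) (hB : tabs3 S h k l U ≤ S) :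
    TMem3 S h k l (fun ρ σ τ => Real.exp (u ρ σ τ)) (texpComp3 S h k l D K U) := by
  intro ρ σ τ hρ hσ hτ
  obtain ⟨p, hp, hev⟩ := tmem3_horner hS h0 k0 l0 D hu (expSerCoeffs K) ρ σ τ hρ hσ hτ
  have hSr : (0 : ℝ) < S := by exact_mod_cast hS
  have habs := abs_le_tabs3 h0 k0 l0 hu hρ hσ hτ
  have huB : |u ρ σ τ| ≤ ((tabs3 S h k l U : ℤ) : ℝ) / S := by rw [le_div_iff₀ hSr]; exact habs
  have hu1 : |u ρ σ τ| ≤ 1 := by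
    have : ((tabs3 S h k l U : ℤ) : ℝ) ≤ S := by exact_mod_cast hB
    exact huB.trans ((div_le_one hSr).2 this)
  have hδle : |Real.exp (u ρ σ τ) - Poly.eval (expSerCoeffs K) (u ρ σ τ)| * S ≤
      (texpCompRem S (tabs3 S h k l U) K : ℝ) := by
    have h1 := abs_exp_sub_eval_expSer_le_tv hu1 hK
    have h2 : |u ρ σ τ| ^ K ≤ (((tabs3 S h k l U : ℤ) : ℝ) / S) ^ K := pow_le_pow_left₀ (abs_nonneg _) huB K
    have hc : (0 : ℝ) ≤ (K + 1 : ℝ) / ((K.factorial : ℝ) * K) := by positivity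
    have h3 := h1.trans (mul_le_mul_of_nonneg_right h2 hc)
    have h4 : ((S : ℚ) * (((((tabs3 S h k l U : ℤ) : ℚ) / S) ^ K) * ((K + 1 : ℚ) / ((K.factorial : ℚ) * K))) : ℝ) ≤
        (texpCompRem S (tabs3 S h k l U) K : ℝ) := by
      unfold texpCompRem; exact_mod_cast Int.le_ceil _
    refine le_trans ?_ h4
    push_cast
    rw [mul_comm ((S : ℕ) : ℝ)]
    exact mul_le_mul_of_nonneg_right h3 hSr.le
  obtain ⟨q, hq, hev2⟩ := exists_widen000 hp hδle ρ σ τ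
  exact ⟨q, hq, by rw [hev2, ← hev]; ring⟩

/-- The rational midpoint of the constant coefficient (`0` for a model without one). [cite: MakinoBerz2003, Definition 3] -/
def mid000 (S : ℕ) : IPoly3 → ℚ
  | ((I :: _) :: _) :: _ => ((I.lo + I.hi : ℤ) : ℚ) / (2 * (S : ℚ))
  | _ => 0

/-- **The trivariate Taylor model of `exp ∘ g`** with its acceptance flag: `c = mid000 S G`,
`e^{g} = e^{c} · e^{g − c}` with `e^{c} ∈ MI.expPt S Ke ke (ofRat S c)`, `|g − c|·S ≤ tabs3 ≤ S`, `0 < K`.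
[cite: MakinoBerz2003, Definition 3] -/
def texp3TM (S : ℕ) (h k l : ℚ) (D K Ke ke : ℕ) (G : IPoly3) : IPoly3 × Bool :=
  let c := mid000 S G
  let U := tsub3 G (tconst3 (ofRat S c))
  match MI.expPt S Ke ke (ofRat S c) with
  | none => ([], false)
  | some E => (tsmulI3 S E (texpComp3 S h k l D K U), decide (0 < K) && decide (tabs3 S h k l U ≤ S))

/-- **Soundness of `texp3TM`**: if `G` encloses `g` on the box and the flag is raised, the returned model encloses
`(ρ, σ, τ) ↦ e^{g(ρ, σ, τ)}`. [cite: MakinoBerz2003, Definition 3] -/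
theorem tmem3_exp_of_texp3TM {S : ℕ} (hS : 0 < S) {h k l : ℚ} (h0 : 0 ≤ h) (k0 : 0 ≤ k) (l0 : 0 ≤ l)
    {D K Ke ke : ℕ} {g : ℝ → ℝ → ℝ → ℝ} {G : IPoly3} (hg : TMem3 S h k l g G)
    (hok : (texp3TM S h k l D K Ke ke G).2 = true) :
    TMem3 S h k l (fun ρ σ τ => Real.exp (g ρ σ τ)) (texp3TM S h k l D K Ke ke G).1 := by
  unfold texp3TM at hok ⊢
  rcases hE : MI.expPt S Ke ke (ofRat S (mid000 S G)) with _ | E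
  · simp only [hE] at hok; exact absurd hok Bool.false_ne_true
  · simp only [hE, Bool.and_eq_true, decide_eq_true_eq] at hok ⊢
    obtain ⟨hK, hB⟩ := hok
    have hexpc := MI.mem_expPt hS hE (mem_ofRat S (mid000 S G))
    have hU : TMem3 S h k l (fun ρ σ τ => g ρ σ τ - ((mid000 S G : ℚ) : ℝ))
        (tsub3 G (tconst3 (ofRat S (mid000 S G)))) :=
      tmem3_sub hg (tmem3_const (mem_ofRat S _))
    have hprod := tmem3_smulI hS hexpc (tmem3_expComp hS h0 k0 l0 D hK hU hB)
    intro ρ σ τ hρ hσ hτ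
    obtain ⟨p, hp, hev⟩ := hprod ρ σ τ hρ hσ hτ
    refine ⟨p, hp, ?_⟩
    rw [← hev]
    show Real.exp (g ρ σ τ) =
      Real.exp ((mid000 S G : ℚ) : ℝ) * Real.exp (g ρ σ τ - ((mid000 S G : ℚ) : ℝ))
    rw [← Real.exp_add]
    congr 1
    ring

/-! ### The relative deviation and the reciprocal -/

/-- The relative deviation from the constant part: `u = c⁻¹ · (G − c)`, `c = mid000 S G`.
[cite: MakinoBerz2003, Definition 3] -/
def trelDev3 (S : ℕ) (G : IPoly3) : IPoly3 :=
  tsmulI3 S (ofRat S (mid000 S G)⁻¹) (tsub3 G (tconst3 (ofRat S (mid000 S G))))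

/-- [cite: MakinoBerz2003, Definition 3] -/
theorem tmem3_relDev {S : ℕ} (hS : 0 < S) {h k l : ℚ} {g : ℝ → ℝ → ℝ → ℝ} {G : IPoly3} (hg : TMem3 S h k l g G) :
    TMem3 S h k l (fun ρ σ τ => (((mid000 S G)⁻¹ : ℚ) : ℝ) * (g ρ σ τ - ((mid000 S G : ℚ) : ℝ))) (trelDev3 S G) :=
  tmem3_smulI hS (mem_ofRat S _) (tmem3_sub hg (tmem3_const (mem_ofRat S _)))

/-- Passing from the real bound `B·S/m` to the integer `⌈B·S/m⌉` used as widening amount. [folklore] -/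
private theorem le_ceil_scaled_tv {x : ℝ} {S : ℕ} {B m : ℤ} (hx : x ≤ (B : ℝ) * S / m) :
    x ≤ ((⌈((B : ℚ) * S) / (m : ℚ)⌉ : ℤ) : ℝ) := by
  refine hx.trans ?_
  have h := (Int.le_ceil (((B : ℚ) * S) / (m : ℚ)))
  have h' : ((((B : ℚ) * S) / (m : ℚ) : ℚ) : ℝ) ≤ ((⌈((B : ℚ) * S) / (m : ℚ)⌉ : ℤ) : ℝ) := by exact_mod_cast h
  push_cast at h'
  exact h'

/-- `|1/g − q|·S ≤ B·S/m` from `m ≤ |g|·S`, `0 < m` and `|1 − g q|·S ≤ B`. [folklore] -/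
private theorem inv_resid_bound_tv {g q S m B : ℝ} (hS : 0 < S) (hm : 0 < m) (hgm : m ≤ |g| * S)
    (hRB : |1 - g * q| * S ≤ B) : |g⁻¹ - q| * S ≤ B * S / m := by
  have hgpos : 0 < |g| := by
    rcases (abs_nonneg g).eq_or_lt with h | h
    · rw [← h, zero_mul] at hgm; linarith
    · exact h
  have hg0 : g ≠ 0 := abs_pos.mp hgpos
  have hB0 : 0 ≤ B := le_trans (mul_nonneg (abs_nonneg _) hS.le) hRB
  have e1 : g⁻¹ - q = (1 - g * q) / g := by field_simp
  rw [e1, abs_div, div_mul_eq_mul_div, div_le_iff₀ hgpos, div_mul_eq_mul_div, le_div_iff₀ hm]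
  have h3 : B * m ≤ B * (|g| * S) := mul_le_mul_of_nonneg_left hgm hB0
  have h4 : |1 - g * q| * S * m ≤ B * m := mul_le_mul_of_nonneg_right hRB hm.le
  nlinarith

/-- **A posteriori validation of a reciprocal candidate** in three variables: `Q` widened by `⌈B·S/m⌉` in its
constant coefficient, `m = tabsLower3 G`, `B` the range bound of the residual `1 − G·Q`; accepted iff `0 < m`.
[cite: Joldes2011, Algorithm 2.2.4] [cite: MakinoBerz2003, Definition 3] -/
def tinvVerify3 (S : ℕ) (h k l : ℚ) (D : ℕ) (G Q : IPoly3) : IPoly3 × Bool :=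
  let m : ℤ := tabsLower3 S h k l G
  let B : ℤ := tabs3 S h k l (tsub3 (tconst3 (MI.ofInt S 1)) (tmul3 S h k l D G Q))
  (widen000 Q ⌈((B : ℚ) * S) / (m : ℚ)⌉, decide (0 < m))

/-- **Soundness of `tinvVerify3`** (accepted ⇒ `g ≠ 0` on the box and the model encloses `1/g`).
[cite: Joldes2011, Algorithm 2.2.4] [cite: MakinoBerz2003, Definition 3] -/
theorem tmem3_inv_of_tinvVerify3 {S : ℕ} (hS : 0 < S) {h k l : ℚ} (h0 : 0 ≤ h) (k0 : 0 ≤ k) (l0 : 0 ≤ l)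
    {D : ℕ} {g q : ℝ → ℝ → ℝ → ℝ} {G Q : IPoly3} (hg : TMem3 S h k l g G) (hq : TMem3 S h k l q Q)
    (hok : (tinvVerify3 S h k l D G Q).2 = true) :
    TMem3 S h k l (fun ρ σ τ => (g ρ σ τ)⁻¹) (tinvVerify3 S h k l D G Q).1 := by
  unfold tinvVerify3 at hok ⊢
  simp only [decide_eq_true_eq] at hok ⊢
  intro ρ σ τ hρ hσ hτ
  have hSr : (0 : ℝ) < S := by exact_mod_cast hS
  have hgm := tabsLower3_le h0 k0 l0 hg hρ hσ hτ
  have hmR : (0 : ℝ) < (tabsLower3 S h k l G : ℤ) := by exact_mod_cast hok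
  have h1 : TMem3 S h k l (fun _ _ _ => (1 : ℝ)) (tconst3 (MI.ofInt S 1)) := by
    simpa using tmem3_const (S := S) (h := h) (k := k) (l := l) (x := (1 : ℝ)) (by simpa using MI.mem_ofInt S 1)
  have hres : TMem3 S h k l (fun ρ σ τ => 1 - g ρ σ τ * q ρ σ τ)
      (tsub3 (tconst3 (MI.ofInt S 1)) (tmul3 S h k l D G Q)) :=
    tmem3_sub h1 (tmem3_mul hS h0 k0 l0 D hg hq)
  have hRB := abs_le_tabs3 h0 k0 l0 hres hρ hσ hτ
  have hbound := inv_resid_bound_tv hSr hmR hgm hRB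
  have hδ := le_ceil_scaled_tv hbound
  obtain ⟨p, hp, ev⟩ := hq ρ σ τ hρ hσ hτ
  obtain ⟨p', hp', ev'⟩ := exists_widen000 hp hδ ρ σ τ
  exact ⟨p', hp', by rw [ev', ← ev]; ring⟩

/-- **The trivariate Taylor model of `1/g`** with its acceptance flag: candidate `c⁻¹ · Σ_{i ≤ K} (−u)^i`
(`geomCoeffs`), validated by `tinvVerify3`. [cite: Joldes2011, Algorithm 2.2.4] [cite: MakinoBerz2003, Definition 3]
[cite: Eble2007, Sect. 2.2.2] -/
def tinv3TM (S : ℕ) (h k l : ℚ) (D K : ℕ) (G : IPoly3) : IPoly3 × Bool :=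
  tinvVerify3 S h k l D G
    (tsmulI3 S (ofRat S (mid000 S G)⁻¹) (thorner3 S h k l D (geomCoeffs K) (trelDev3 S G)))

/-- **Soundness of `tinv3TM`.** [cite: Joldes2011, Algorithm 2.2.4] [cite: MakinoBerz2003, Definition 3] -/
theorem tmem3_inv_of_tinv3TM {S : ℕ} (hS : 0 < S) {h k l : ℚ} (h0 : 0 ≤ h) (k0 : 0 ≤ k) (l0 : 0 ≤ l)
    {D K : ℕ} {g : ℝ → ℝ → ℝ → ℝ} {G : IPoly3} (hg : TMem3 S h k l g G)
    (hok : (tinv3TM S h k l D K G).2 = true) :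
    TMem3 S h k l (fun ρ σ τ => (g ρ σ τ)⁻¹) (tinv3TM S h k l D K G).1 := by
  have hq := tmem3_smulI hS (h := h) (k := k) (l := l) (mem_ofRat S (mid000 S G)⁻¹)
    (tmem3_horner hS h0 k0 l0 D (tmem3_relDev hS hg) (geomCoeffs K))
  exact tmem3_inv_of_tinvVerify3 hS h0 k0 l0 hg hq hok

/-! ### The square root -/

/-- `|√g − q|·q ≤ |g − q²|` for `0 < q` and every real `g`. [folklore] -/
private theorem abs_sqrt_sub_mul_le_tv {g q : ℝ} (hq : 0 < q) : |Real.sqrt g - q| * q ≤ |g - q * q| := by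
  rcases le_or_gt 0 g with hg | hg
  · have hsq : Real.sqrt g * Real.sqrt g = g := Real.mul_self_sqrt hg
    have hsum : 0 < Real.sqrt g + q := by positivity
    have e1 : Real.sqrt g - q = (g - q * q) / (Real.sqrt g + q) := by
      rw [eq_div_iff hsum.ne']
      linear_combination hsq
    rw [e1, abs_div, abs_of_pos hsum, div_mul_eq_mul_div, div_le_iff₀ hsum]
    exact mul_le_mul_of_nonneg_left (by linarith [Real.sqrt_nonneg g]) (abs_nonneg _)
  · rw [Real.sqrt_eq_zero'.mpr hg.le, zero_sub, abs_neg, abs_of_pos hq,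
      abs_of_nonpos (by nlinarith : g - q * q ≤ 0)]
    nlinarith

/-- `|√g − q|·S ≤ B·S/s` from `0 < s ≤ q·S` and `|g − q²|·S ≤ B`. [folklore] -/
private theorem sqrt_resid_bound_tv {g q S s B : ℝ} (hS : 0 < S) (hs : 0 < s) (hqs : s ≤ q * S)
    (hRB : |g - q * q| * S ≤ B) : |Real.sqrt g - q| * S ≤ B * S / s := by
  have hq : 0 < q := by
    rcases lt_or_ge 0 q with hq | hq
    · exact hq
    · have : q * S ≤ 0 := mul_nonpos_of_nonpos_of_nonneg hq hS.le
      linarith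
  have h1 := abs_sqrt_sub_mul_le_tv (g := g) hq
  have h4 : |Real.sqrt g - q| * s ≤ B := by
    have h2 : |Real.sqrt g - q| * s ≤ |Real.sqrt g - q| * (q * S) := mul_le_mul_of_nonneg_left hqs (abs_nonneg _)
    have h3 : |Real.sqrt g - q| * q * S ≤ |g - q * q| * S := mul_le_mul_of_nonneg_right h1 hS.le
    nlinarith
  rw [le_div_iff₀ hs]
  calc |Real.sqrt g - q| * S * s = (|Real.sqrt g - q| * s) * S := by ring
    _ ≤ B * S := mul_le_mul_of_nonneg_right h4 hS.le

/-- **A posteriori validation of a square-root candidate** in three variables: `Q` widened by `⌈B·S/s⌉` in its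
constant coefficient, `s = tlower3 Q`, `B` the range bound of the residual `G − Q·Q`; accepted iff `0 < s`.
[cite: Eble2007, Sect. 2.2.2] [cite: MakinoBerz2003, Definition 3] -/
def tsqrtVerify3 (S : ℕ) (h k l : ℚ) (D : ℕ) (G Q : IPoly3) : IPoly3 × Bool :=
  let s : ℤ := tlower3 S h k l Q
  let B : ℤ := tabs3 S h k l (tsub3 G (tmul3 S h k l D Q Q))
  (widen000 Q ⌈((B : ℚ) * S) / (s : ℚ)⌉, decide (0 < s))

/-- **Soundness of `tsqrtVerify3`.** [cite: Eble2007, Sect. 2.2.2] [cite: MakinoBerz2003, Definition 3] -/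
theorem tmem3_sqrt_of_tsqrtVerify3 {S : ℕ} (hS : 0 < S) {h k l : ℚ} (h0 : 0 ≤ h) (k0 : 0 ≤ k) (l0 : 0 ≤ l)
    {D : ℕ} {g q : ℝ → ℝ → ℝ → ℝ} {G Q : IPoly3} (hg : TMem3 S h k l g G) (hq : TMem3 S h k l q Q)
    (hok : (tsqrtVerify3 S h k l D G Q).2 = true) :
    TMem3 S h k l (fun ρ σ τ => Real.sqrt (g ρ σ τ)) (tsqrtVerify3 S h k l D G Q).1 := by
  unfold tsqrtVerify3 at hok ⊢
  simp only [decide_eq_true_eq] at hok ⊢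
  intro ρ σ τ hρ hσ hτ
  have hSr : (0 : ℝ) < S := by exact_mod_cast hS
  have hqs := tlower3_le h0 k0 l0 hq hρ hσ hτ
  have hsR : (0 : ℝ) < (tlower3 S h k l Q : ℤ) := by exact_mod_cast hok
  have hres : TMem3 S h k l (fun ρ σ τ => g ρ σ τ - q ρ σ τ * q ρ σ τ) (tsub3 G (tmul3 S h k l D Q Q)) :=
    tmem3_sub hg (tmem3_mul hS h0 k0 l0 D hq hq)
  have hRB := abs_le_tabs3 h0 k0 l0 hres hρ hσ hτ
  have hbound := sqrt_resid_bound_tv hSr hsR hqs hRB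
  have hδ := le_ceil_scaled_tv hbound
  obtain ⟨p, hp, ev⟩ := hq ρ σ τ hρ hσ hτ
  obtain ⟨p', hp', ev'⟩ := exists_widen000 hp hδ ρ σ τ
  exact ⟨p', hp', by rw [ev', ← ev]; ring⟩

/-- **The trivariate Taylor model of `√g`** with its acceptance flag: candidate
`heronQ S c fuel · Σ_{i ≤ K} binom(1/2, i) u^i`, validated by `tsqrtVerify3`. [cite: Eble2007, Sect. 2.2.2]
[cite: MakinoBerz2003, Definition 3] -/
def tsqrt3TM (S : ℕ) (h k l : ℚ) (D K fuel : ℕ) (G : IPoly3) : IPoly3 × Bool :=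
  tsqrtVerify3 S h k l D G
    (tsmulI3 S (ofRat S (heronQ S (mid000 S G) fuel)) (thorner3 S h k l D (binomHalfCoeffs K) (trelDev3 S G)))

/-- **Soundness of `tsqrt3TM`.** [cite: Eble2007, Sect. 2.2.2] [cite: MakinoBerz2003, Definition 3] -/
theorem tmem3_sqrt_of_tsqrt3TM {S : ℕ} (hS : 0 < S) {h k l : ℚ} (h0 : 0 ≤ h) (k0 : 0 ≤ k) (l0 : 0 ≤ l)
    {D K fuel : ℕ} {g : ℝ → ℝ → ℝ → ℝ} {G : IPoly3} (hg : TMem3 S h k l g G)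
    (hok : (tsqrt3TM S h k l D K fuel G).2 = true) :
    TMem3 S h k l (fun ρ σ τ => Real.sqrt (g ρ σ τ)) (tsqrt3TM S h k l D K fuel G).1 := by
  have hq := tmem3_smulI hS (h := h) (k := k) (l := l) (mem_ofRat S (heronQ S (mid000 S G) fuel))
    (tmem3_horner hS h0 k0 l0 D (tmem3_relDev hS hg) (binomHalfCoeffs K))
  exact tmem3_sqrt_of_tsqrtVerify3 hS h0 k0 l0 hg hq hok

/-! ### The logarithm -/

/-- **The logarithmic series with remainder**: for `|u| < 1`,
`|log(1+u) − Σ_{k ≤ K} c_k u^k| ≤ |u|^{K+1}/(1 − |u|)` (`c = log1pCoeffs K`). [folklore] -/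
private theorem abs_log_one_add_sub_eval_le_tv {u : ℝ} (hu : |u| < 1) (K : ℕ) :
    |Real.log (1 + u) - Poly.eval (log1pCoeffs K) u| ≤ |u| ^ (K + 1) / (1 - |u|) := by
  have h := Real.abs_log_sub_add_sum_range_le (x := -u) (by rwa [abs_neg]) K
  rw [abs_neg, sub_neg_eq_add] at h
  have hs : Poly.eval (log1pCoeffs K) u = -∑ i ∈ Finset.range K, (-u) ^ (i + 1) / (i + 1) := by
    rw [log1pCoeffs, poly_eval_map_range, Finset.sum_range_succ', ← Finset.sum_neg_distrib]
    simp only [Nat.cast_zero, pow_zero, mul_one]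
    push_cast
    simp only [pow_one, div_zero, add_zero]
    refine Finset.sum_congr rfl fun k _ => ?_
    rw [neg_pow]
    ring
  rw [hs, sub_neg_eq_add, add_comm]
  exact h

/-- The trivariate Taylor model of `log(1 + u)`: Horner on `log1pCoeffs K` plus the remainder
`tlog1pRem S (tabs3 U) K` in the constant coefficient. [cite: Joldes2011, Section 2.2.1] [cite: MakinoBerz2003, Definition 3] -/
def tlog1p3 (S : ℕ) (h k l : ℚ) (D K : ℕ) (U : IPoly3) : IPoly3 :=
  widen000 (thorner3 S h k l D (log1pCoeffs K) U) (tlog1pRem S (tabs3 S h k l U) K)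

/-- **Soundness of `tlog1p3`** (`tabs3 S h k l U < S` certifies `|u| < 1`). [cite: Joldes2011, Section 2.2.1]
[cite: MakinoBerz2003, Definition 3] -/
theorem tmem3_log1p3 {S : ℕ} (hS : 0 < S) {h k l : ℚ} (h0 : 0 ≤ h) (k0 : 0 ≤ k) (l0 : 0 ≤ l) (D K : ℕ)
    {u : ℝ → ℝ → ℝ → ℝ} {U : IPoly3} (hu : TMem3 S h k l u U) (hB : tabs3 S h k l U < S) :
    TMem3 S h k l (fun ρ σ τ => Real.log (1 + u ρ σ τ)) (tlog1p3 S h k l D K U) := by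
  intro ρ σ τ hρ hσ hτ
  obtain ⟨p, hp, hev⟩ := tmem3_horner hS h0 k0 l0 D hu (log1pCoeffs K) ρ σ τ hρ hσ hτ
  have hSr : (0 : ℝ) < S := by exact_mod_cast hS
  have habs := abs_le_tabs3 h0 k0 l0 hu hρ hσ hτ
  have hB1 : ((tabs3 S h k l U : ℤ) : ℝ) / S < 1 := by
    rw [div_lt_one hSr]; exact_mod_cast hB
  have huB : |u ρ σ τ| ≤ ((tabs3 S h k l U : ℤ) : ℝ) / S := by rw [le_div_iff₀ hSr]; exact habs
  have hu1 : |u ρ σ τ| < 1 := lt_of_le_of_lt huB hB1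
  have hB0 : 0 ≤ ((tabs3 S h k l U : ℤ) : ℝ) / S := (abs_nonneg _).trans huB
  have hδle : |Real.log (1 + u ρ σ τ) - Poly.eval (log1pCoeffs K) (u ρ σ τ)| * S ≤
      (tlog1pRem S (tabs3 S h k l U) K : ℝ) := by
    have h1 := abs_log_one_add_sub_eval_le_tv hu1 K
    have hnum : |u ρ σ τ| ^ (K + 1) ≤ (((tabs3 S h k l U : ℤ) : ℝ) / S) ^ (K + 1) :=
      pow_le_pow_left₀ (abs_nonneg _) huB _
    have h2 : |u ρ σ τ| ^ (K + 1) / (1 - |u ρ σ τ|) ≤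
        (((tabs3 S h k l U : ℤ) : ℝ) / S) ^ (K + 1) / (1 - ((tabs3 S h k l U : ℤ) : ℝ) / S) :=
      div_le_div₀ (pow_nonneg hB0 _) hnum (by linarith) (by linarith)
    have h3 := h1.trans h2
    have h4 : ((S : ℚ) * (((((tabs3 S h k l U : ℤ) : ℚ) / S) ^ (K + 1)) /
        (1 - ((tabs3 S h k l U : ℤ) : ℚ) / S)) : ℝ) ≤ (tlog1pRem S (tabs3 S h k l U) K : ℝ) := by
      unfold tlog1pRem; exact_mod_cast Int.le_ceil _
    refine le_trans ?_ h4
    push_cast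
    rw [mul_comm ((S : ℕ) : ℝ)]
    exact mul_le_mul_of_nonneg_right h3 hSr.le
  obtain ⟨q, hq, hev2⟩ := exists_widen000 hp hδle ρ σ τ
  exact ⟨q, hq, by rw [hev2, ← hev]; ring⟩

/-- **The trivariate Taylor model of `log ∘ g`** with its acceptance flag: `c = mid000 S G`, `u = (g − c)/c`,
`log g = log c + log(1 + u)`, `log c ∈ MI.logPos S Kl (ofRat S c)`, `tabs3 (trelDev3 G) < S`.
[cite: Joldes2011, Algorithm 2.2.8] [cite: MakinoBerz2003, Definition 3] [cite: Eble2007, Sect. 2.2.2] -/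
def tlog3TM (S : ℕ) (h k l : ℚ) (D K Kl : ℕ) (G : IPoly3) : IPoly3 × Bool :=
  match MI.logPos S Kl (ofRat S (mid000 S G)) with
  | none => ([], false)
  | some L => (tadd3 (tconst3 L) (tlog1p3 S h k l D K (trelDev3 S G)), decide (tabs3 S h k l (trelDev3 S G) < S))

/-- **Soundness of `tlog3TM`** (accepted ⇒ `g > 0` on the box and the model encloses `log g`).
[cite: Joldes2011, Algorithm 2.2.8] [cite: MakinoBerz2003, Definition 3] -/
theorem tmem3_log_of_tlog3TM {S : ℕ} (hS : 0 < S) {h k l : ℚ} (h0 : 0 ≤ h) (k0 : 0 ≤ k) (l0 : 0 ≤ l)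
    {D K Kl : ℕ} {g : ℝ → ℝ → ℝ → ℝ} {G : IPoly3} (hg : TMem3 S h k l g G)
    (hok : (tlog3TM S h k l D K Kl G).2 = true) :
    TMem3 S h k l (fun ρ σ τ => Real.log (g ρ σ τ)) (tlog3TM S h k l D K Kl G).1 := by
  unfold tlog3TM at hok ⊢
  rcases hL : MI.logPos S Kl (ofRat S (mid000 S G)) with _ | L
  · simp only [hL] at hok; exact absurd hok Bool.false_ne_true
  · simp only [hL, decide_eq_true_eq] at hok ⊢
    obtain ⟨hc0, hlogc⟩ := MI.mem_logPos hS hL (mem_ofRat S (mid000 S G))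
    have hU := tmem3_relDev hS hg
    have hsum := tmem3_add (tmem3_const (h := h) (k := k) (l := l) hlogc) (tmem3_log1p3 hS h0 k0 l0 D K hU hok)
    intro ρ σ τ hρ hσ hτ
    obtain ⟨p, hp, hev⟩ := hsum ρ σ τ hρ hσ hτ
    refine ⟨p, hp, ?_⟩
    rw [← hev]
    have hSr : (0 : ℝ) < S := by exact_mod_cast hS
    have habs := abs_le_tabs3 h0 k0 l0 hU hρ hσ hτ
    have hlt : (tabs3 S h k l (trelDev3 S G) : ℝ) < S := by exact_mod_cast hok
    have hu1 : |(((mid000 S G)⁻¹ : ℚ) : ℝ) * (g ρ σ τ - ((mid000 S G : ℚ) : ℝ))| < 1 := by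
      nlinarith [abs_nonneg ((((mid000 S G)⁻¹ : ℚ) : ℝ) * (g ρ σ τ - ((mid000 S G : ℚ) : ℝ)))]
    have hpos : 0 < 1 + (((mid000 S G)⁻¹ : ℚ) : ℝ) * (g ρ σ τ - ((mid000 S G : ℚ) : ℝ)) := by
      have := (abs_lt.1 hu1).1; linarith
    have hc0' : ((mid000 S G : ℚ) : ℝ) ≠ 0 := hc0.ne'
    have e : Real.log (g ρ σ τ) = Real.log ((mid000 S G : ℚ) : ℝ) +
        Real.log (1 + (((mid000 S G)⁻¹ : ℚ) : ℝ) * (g ρ σ τ - ((mid000 S G : ℚ) : ℝ))) := by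
      rw [← Real.log_mul hc0' hpos.ne']
      congr 1
      push_cast
      field_simp
      ring
    exact e

end PolyMP

end Literature.Analysis.ValidatedNumerics
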